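import Mathlib

/-!
# Stub `stub_tangencySets` (crux `LevelOneGL2Designs`, stmt-MatrixMultiplication-14080) —
wall-breaker axis 6/12, part 2: the dilation pencil (an algebraic family with a decidable
certificate) and its certified instances

The stub asks for strong representative systems (SRS) of `AG(2,p)` in dot-product normal form of
size `c·p^{3/2}` for unboundedly many primes `p` (= induced matchings of the point–line incidence
graph of `𝔽_p²`, `IM(2,p)` in Hunter–Pohoata–Verstraëte–Zhang, arXiv:2601.19879, whose
Conjecture 10.2 predicts `IM(2,p) ≤ p^{3/2-c}` for all large primes, i.e. that the stub fails).
This file records the HOMOGENEOUS (orbit) sub-axis of the random-algebraic axis: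

* `stub_tangencySets_dilationPencil_srs` — for `A, B ⊆ 𝔽_p ∖ {0}` with `A` closed under
  quotients and `μ·w(2−w) ∉ B` whenever `μ ∈ B`, `1 ≠ w ∈ A`, the `|A|·|B|` flags
  `((x, μx²), (2/x, −1/(μx²)))` — each point of the parabola `y = μX²` (`μ ∈ B`, abscissa in
  `A`) with its own tangent — form an SRS.  For a multiplicative subgroup `A = B` the hypothesis
  is the one-line certificate `A ∩ (2 − A) = {1}`.
* certified instances `srs_dilationPencil_19/37/127` (`A = μ₆, μ₉, μ₂₁`; `36, 81, 441` flags,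
  ratios `0.43, 0.36, 0.31` to `p^{3/2}`).

Why the family cannot reach the stub: `#{w ∈ A : 2 − w ∈ A} = |A|²/p + O(√p)` (Weil bound for
the Fermat curve `x^k + y^k = 2`, `k = (p−1)/|A|`), so `|A|² ≥ c·p^{3/2}` requires the main term
`c√p` to be cancelled by `(k−1)(k−2) ≍ √p` Jacobi sums of modulus `√p` — a conspiracy with no
mechanism over prime fields; a scan of all primes `p ≤ 3000` and all subgroups / coset unions
(seat evidence `comp/orbit/pencil_scan.py`) finds the best ratio `|S|/p^{3/2}` of the family
`≤ 0.18` for every `p > 500`.  Mathlib only; no new definitions.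
-/

set_option linter.dupNamespace false

open scoped BigOperators

namespace Summit.MatrixMultiplication.MatrixMultiplication.Theorems.LevelOneGL2Designs.TangencyDilationPencil

section DilationPencil

/-- **The dilation pencil (an algebraic family with a one-line certificate).**  Let
`A, B ⊆ 𝔽_p ∖ {0}` with `A` closed under quotients (`∀ x x' ∈ A, ∃ w ∈ A, w·x' = x`) and
`μ·w(2−w) ∉ B` whenever `μ ∈ B`, `w ∈ A`, `w ≠ 1`.  Then the `|A|·|B|` flags
`((x, μx²), (2/x, −1/(μx²)))` — each point of the parabola `y = μX²` (`μ ∈ B`) with abscissa in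
`A`, together with its own tangent `y = 2μx·X − μx²` — form a strong representative system: the
tangent at `(x, μx²)` meets the parabola `y = μ'X²` above the abscissa `x' = x/w` iff
`μ' = μ·w(2−w)`.  For a subgroup `A = B` the hypothesis reads `A ∩ (2 − A) = {1}`.
[elementary; construction of this axis] -/
theorem stub_tangencySets_dilationPencil_srs (p : ℕ) [Fact p.Prime] (A B : Finset (ZMod p))
    (hA0 : (0 : ZMod p) ∉ A) (hB0 : (0 : ZMod p) ∉ B)
    (hdiv : ∀ x ∈ A, ∀ x' ∈ A, ∃ w ∈ A, w * x' = x)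
    (hT : ∀ μ ∈ B, ∀ w ∈ A, w ≠ 1 → μ * (w * (2 - w)) ∉ B) :
    ∃ S : Finset ((Fin 2 → ZMod p) × (Fin 2 → ZMod p)), S.card = A.card * B.card ∧
      ∀ f ∈ S, ∀ f' ∈ S, (dotProduct f.1 f'.2 = 1 ↔ f = f') := by
  classical
  let Φ : ZMod p × ZMod p → (Fin 2 → ZMod p) × (Fin 2 → ZMod p) :=
    fun q => (![q.1, q.2 * q.1 ^ 2], ![2 * q.1⁻¹, -(q.2 * q.1 ^ 2)⁻¹])
  have hne : ∀ q ∈ A ×ˢ B, q.1 ≠ 0 ∧ q.2 ≠ 0 := by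
    intro q hq
    rw [Finset.mem_product] at hq
    exact ⟨fun h => hA0 (h ▸ hq.1), fun h => hB0 (h ▸ hq.2)⟩
  have hinj : Set.InjOn Φ (A ×ˢ B : Finset (ZMod p × ZMod p)) := by
    intro q hq q' hq' h
    have h1 := congrArg Prod.fst h
    simp only [Φ] at h1
    have hx : q.1 = q'.1 := by simpa using congrFun h1 0
    have hy : q.2 * q.1 ^ 2 = q'.2 * q'.1 ^ 2 := by simpa using congrFun h1 1
    have hx0 : q.1 ≠ 0 := (hne q hq).1
    rw [← hx] at hy
    have : q.2 = q'.2 := by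
      have := mul_right_cancel₀ (pow_ne_zero 2 hx0) hy
      exact this
    exact Prod.ext hx this
  -- the incidence computation
  have hdot : ∀ q q' : ZMod p × ZMod p, dotProduct (Φ q').1 (Φ q).2 =
      2 * q'.1 * q.1⁻¹ - q'.2 * q'.1 ^ 2 * (q.2 * q.1 ^ 2)⁻¹ := by
    intro q q'
    simp only [Φ, dotProduct, Fin.sum_univ_two, Matrix.cons_val_zero, Matrix.cons_val_one]
    ring
  refine ⟨(A ×ˢ B).image Φ, by rw [Finset.card_image_of_injOn hinj, Finset.card_product], ?_⟩
  simp only [Finset.mem_image]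
  rintro _ ⟨q, hq, rfl⟩ _ ⟨q', hq', rfl⟩
  rw [hinj.eq_iff hq hq']
  obtain ⟨hx0, hμ0⟩ := hne q hq
  obtain ⟨hx0', hμ0'⟩ := hne q' hq'
  rw [Finset.mem_product] at hq hq'
  -- note the roles: `f = Φ q` is the point side, `f' = Φ q'` the line side
  rw [hdot q' q]
  constructor
  · intro h
    -- write `x' = w · x` with `w ∈ A` (`x` the point's abscissa, `x'` the tangent's)
    obtain ⟨w, hw, hwx⟩ := hdiv q'.1 hq'.1 q.1 hq.1
    have hw0 : w ≠ 0 := fun h0 => hA0 (h0 ▸ hw)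
    have hfrac : 2 * q.1 * q'.1⁻¹ - q.2 * q.1 ^ 2 * (q'.2 * q'.1 ^ 2)⁻¹ =
        (2 * w * q'.2 - q.2) / (q'.2 * w ^ 2) := by
      rw [← hwx]
      field_simp
    rw [hfrac, div_eq_one_iff_eq (mul_ne_zero hμ0' (pow_ne_zero 2 hw0))] at h
    have key : q.2 = q'.2 * (w * (2 - w)) := by linear_combination -h
    by_cases hw1 : w = 1
    · subst hw1
      rw [one_mul] at hwx
      refine Prod.ext hwx ?_
      rw [key]; ring
    · exact absurd (key ▸ hq.2) (hT q'.2 hq'.2 w hw hw1)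
  · rintro rfl
    have e1 : (2 : ZMod p) * q.1 * q.1⁻¹ = 2 := by rw [mul_assoc, mul_inv_cancel₀ hx0, mul_one]
    have e2 : q.2 * q.1 ^ 2 * (q.2 * q.1 ^ 2)⁻¹ = 1 :=
      mul_inv_cancel₀ (mul_ne_zero hμ0 (pow_ne_zero 2 hx0))
    rw [e1, e2]
    norm_num

/-- **Certified instance of the dilation pencil, `p = 19`:** `A = B = μ₆ = {1,7,8,11,12,18}`
(the sixth roots of unity mod 19) satisfies `A ∩ (2 − A) = {1}`, giving an SRS of `AG(2,19)`
with `36` flags (`36/19^{3/2} ≈ 0.43`; the search optimum at `p = 19` is `≥ 66`).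
[computation] -/
theorem srs_dilationPencil_19 :
    ∃ S : Finset ((Fin 2 → ZMod 19) × (Fin 2 → ZMod 19)), S.card = 36 ∧
      ∀ f ∈ S, ∀ f' ∈ S, (dotProduct f.1 f'.2 = 1 ↔ f = f') := by
  obtain ⟨S, hS, h⟩ := @stub_tangencySets_dilationPencil_srs 19 ⟨by norm_num⟩ {1, 7, 8, 11, 12, 18}
    {1, 7, 8, 11, 12, 18} (by decide +kernel) (by decide +kernel) (by decide +kernel)
    (by decide +kernel)
  refine ⟨S, ?_, h⟩
  rw [hS]
  decide +kernel


/-- **Certified instance of the dilation pencil, `p = 37`:** `A = B = μ_9` (the subgroup of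
order 9 of `𝔽_37ˣ`) satisfies `A ∩ (2 − A) = {1}`, giving an SRS of `AG(2,37)` with `81` flags
(`81/37^{3/2} ≈ 0.36`). [computation] -/
theorem srs_dilationPencil_37 :
    ∃ S : Finset ((Fin 2 → ZMod 37) × (Fin 2 → ZMod 37)), S.card = 81 ∧
      ∀ f ∈ S, ∀ f' ∈ S, (dotProduct f.1 f'.2 = 1 ↔ f = f') := by
  obtain ⟨S, hS, h⟩ := @stub_tangencySets_dilationPencil_srs 37 ⟨by norm_num⟩
    {1, 7, 9, 10, 12, 16, 26, 33, 34}
    {1, 7, 9, 10, 12, 16, 26, 33, 34}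
    (by decide +kernel) (by decide +kernel) (by decide +kernel) (by decide +kernel)
  exact ⟨S, by rw [hS]; decide +kernel, h⟩


/-- **Certified instance of the dilation pencil, `p = 127`:** `A = B = μ_21` (the subgroup of
order 21 of `𝔽_127ˣ`) satisfies `A ∩ (2 − A) = {1}`, giving an SRS of `AG(2,127)` with `441` flags
(`441/127^{3/2} ≈ 0.31`). [computation] -/
theorem srs_dilationPencil_127 :
    ∃ S : Finset ((Fin 2 → ZMod 127) × (Fin 2 → ZMod 127)), S.card = 441 ∧
      ∀ f ∈ S, ∀ f' ∈ S, (dotProduct f.1 f'.2 = 1 ↔ f = f') := by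
  obtain ⟨S, hS, h⟩ := @stub_tangencySets_dilationPencil_srs 127 ⟨by norm_num⟩
    {1, 2, 4, 8, 16, 19, 25, 32, 38, 47, 50, 61, 64, 73, 76, 87, 94, 100, 107, 117, 122}
    {1, 2, 4, 8, 16, 19, 25, 32, 38, 47, 50, 61, 64, 73, 76, 87, 94, 100, 107, 117, 122}
    (by decide +kernel) (by decide +kernel) (by decide +kernel) (by decide +kernel)
  exact ⟨S, by rw [hS]; decide +kernel, h⟩

end DilationPencil

end Summit.MatrixMultiplication.MatrixMultiplication.Theorems.LevelOneGL2Designs.TangencyDilationPencil
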